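import Summits.BirchSwinnertonDyer.Rank1Residual.X12.O11.RouteUPrimeMember
import Summits.BirchSwinnertonDyer.Rank1Residual.X12.O11.RouteUBernoulliD11
import Summits.BirchSwinnertonDyer.Rank1Residual.X12.O11.RouteUSeven441d1
import HarnessLib

/-!
# ROUTE U, prime member `D = −47` (curve `49a1^{(−47)}`, `N = 49·47² = 108241`), Heegner field
# `K'' = ℚ(√−19)`: the two Bernoulli-unit certificates and BSD₇ (q INERT in ℚ(√−7): an O11@7 cell, not a 𝒞₇ member) by the prime-member class theorem

bsd-cm cell (run/shared/lean/pub/bsd-cm/), ROUTE U, seat `bsd-cm-ram`. Instance of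
`RouteU.bsdp_seven_of_twist_cm7_prime` at `(q, r) = (47, 19)`: `47 ≡ 19 ≡ 3 (mod 4)`,
`(−19/7) = (−19/47) = 1`. The per-member inputs are the two kernel certificates (`decide +kernel`,
mod-`49` sums of lengths `329` and `6251`, the second in 5 blocks of ≤ 1500 terms):
* `norm_generalizedBernoulli_theta1_D47` — `‖B_{1,ω⁴χ_{−47}}‖₇ = 1` (`S₁ = Σ_{j<329} (j/47)·j²⁹`, `7 ∥ S₁`);
* `norm_generalizedBernoulli_theta2_D47` — `‖B_{1,ωχ_{−47}χ_{−19}}‖₇ = 1` (`S₂ = Σ_{j<6251} (j/47)(j/19)·j⁸`, `7 ∥ S₂`);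
* **`bsdp_seven_of_twist_cm7_D47`** — BSD₇ for every globally minimal model of `49a1^{(−47)}` with
  `r_an = 1`, from the class theorem (named facts: Kriz–Li Thm 1.20 / Rem 3.10, Gross–Zagier, Kolyvagin,
  GZK, modularity, Rubin 1983 Thm C, Burungale–Flach 2024, Buhler–Gross 1985 Ch. II; displayed data:
  Heegner datum over `ℚ(√−19)`, a Mordell–Weil coordinate over `K`, `L(W^{(−19)},1) ≠ 0`, the twin's
  minimal model, `7 ∤ c` (Manin constant)); the descent inputs (no `7`-torsion over `K`, `7 ∤ #Ш(W)`)
  are discharged inside the class theorem.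
THEOREMS ONLY; nothing booked. References: [KrizLi2019] Thm. 1.20; [Washington1997] §5.1, Thm 4.2;
[Rubin1983] Thm C; [BuhlerGross1985] Ch. II; [BurungaleFlach2024] Thm 1.1; [Miller2011LMS] Def. 1.1.
-/

noncomputable section

open scoped Classical
open NumberField WeierstrassCurve DirichletCharacter
open Literature.NumberTheory.EllipticCurves Literature.NumberTheory.EllipticCurves.Rank1Residual
open Literature.NumberTheory.EllipticCurves.KrizLi2019 Literature.NumberTheory.LFunctions
open Literature.NumberTheory.EllipticCurves.ModularForms

namespace Summit.BirchSwinnertonDyer.Rank1Residual.X12.O11.RouteU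

/-- `ord₇ (7·47) = 1`. [folklore] -/
theorem padicValNat_seven_level1_D47 : padicValNat 7 (7 * 47) = 1 := by
  rw [padicValNat.mul (by norm_num) (by norm_num), padicValNat_self, padicValNat.eq_zero_of_not_dvd (by norm_num)]

/-- `ord₇ (7·47·19) = 1`. [folklore] -/
theorem padicValNat_seven_level2_D47 : padicValNat 7 (7 * 47 * 19) = 1 := by
  rw [show (7 * 47 * 19 : ℕ) = 7 * (47 * 19) by ring, padicValNat.mul (by norm_num) (by norm_num),
    padicValNat_self, padicValNat.eq_zero_of_not_dvd (by norm_num)]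

set_option maxRecDepth 400000 in
/-- **`‖B_{1,θ₁}‖₇ = 1`** for every character `θ₁` mod `7·47` with values `(j/47)·ω(j)⁴`, `ω`
Teichmüller (certificate `7 ∥ Σ_{j<329} (j/47) j²⁹`, `decide +kernel`).
[cite: KrizLi2019, Thm. 1.20 (p. 8) and §1.5 (1)] [cite: Washington1997, §5.1 and Thm. 4.2] -/
theorem norm_generalizedBernoulli_theta1_D47 (ω : DirichletCharacter ℚ_[7] 7)
    (hω : IsTeichmullerCharacter ω) (θ : DirichletCharacter ℚ_[7] (7 * 47))
    (hθ : ∀ j : ZMod (7 * 47), θ j = (legendreSym 47 (j.val : ℤ) : ℚ_[7]) * ω (j.val : ZMod 7) ^ 4) :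
    ‖generalizedBernoulli 1 θ‖ = 1 := by
  have hθ1 : θ ≠ 1 := by
    intro h1
    have hv := hθ (((328 : ℕ)) : ZMod (7 * 47))
    have hval : (((328 : ℕ) : ZMod (7 * 47))).val = 328 := by
      rw [ZMod.val_natCast]
    have h6 : (((328 : ℕ)) : ZMod 7) = ((6 : ℕ) : ZMod 7) := by decide
    have hu : IsUnit (((328 : ℕ)) : ZMod (7 * 47)) := by
      rw [ZMod.isUnit_iff_coprime]; norm_num
    rw [h1, hval, MulChar.one_apply hu, h6, apply_neg_one_pow_four, mul_one] at hv
    have hL : legendreSym 47 ((328 : ℕ) : ℤ) = -1 := by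
      rw [legendreSym_eq_ite 47 (by norm_num)]; decide
    rw [hL] at hv
    norm_num at hv
  refine norm_generalizedBernoulli_one_eq_one_of_cert θ hθ1 padicValNat_seven_level1_D47
    (fun j => legendreSym 47 (j.val : ℤ)) 28 (fun j => ?_) ?_ ?_
  · have := norm_sub_le_of_values ω hω θ (fun m => legendreSym 47 (m : ℤ)) 4 (by norm_num) hθ j
    simpa using this
  · simp_rw [legendreSym_eq_ite 47 (by norm_num)]
    decide +kernel
  · simp_rw [legendreSym_eq_ite 47 (by norm_num)]
    decide +kernel

set_option maxRecDepth 400000 in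
/-- Block 0 of the `θ₂` certificate for `D = −47`: `Σ_{0 ≤ j < 1500} (j/47)(j/19) j⁸` evaluated (`decide +kernel`). [folklore] -/
theorem theta2_D47_block0 :
    ∑ j ∈ Finset.Ico (0 : ℕ) 1500, (legendreSym 47 (j : ℤ) * legendreSym 19 (j : ℤ)) * (j : ℤ) ^ (7 + 1) =
      -417679034250639449603825780 := by
  simp_rw [legendreSym_eq_ite 47 (by norm_num), legendreSym_eq_ite 19 (by norm_num)]
  decide +kernel

set_option maxRecDepth 400000 in
/-- Block 1 of the `θ₂` certificate for `D = −47`: `Σ_{1500 ≤ j < 3000} (j/47)(j/19) j⁸` evaluated (`decide +kernel`). [folklore] -/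
theorem theta2_D47_block1 :
    ∑ j ∈ Finset.Ico (1500 : ℕ) 3000, (legendreSym 47 (j : ℤ) * legendreSym 19 (j : ℤ)) * (j : ℤ) ^ (7 + 1) =
      55400192880609081512930388845 := by
  simp_rw [legendreSym_eq_ite 47 (by norm_num), legendreSym_eq_ite 19 (by norm_num)]
  decide +kernel

set_option maxRecDepth 400000 in
/-- Block 2 of the `θ₂` certificate for `D = −47`: `Σ_{3000 ≤ j < 4500} (j/47)(j/19) j⁸` evaluated (`decide +kernel`). [folklore] -/
theorem theta2_D47_block2 :
    ∑ j ∈ Finset.Ico (3000 : ℕ) 4500, (legendreSym 47 (j : ℤ) * legendreSym 19 (j : ℤ)) * (j : ℤ) ^ (7 + 1) =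
      359865960093636084448667269476 := by
  simp_rw [legendreSym_eq_ite 47 (by norm_num), legendreSym_eq_ite 19 (by norm_num)]
  decide +kernel

set_option maxRecDepth 400000 in
/-- Block 3 of the `θ₂` certificate for `D = −47`: `Σ_{4500 ≤ j < 6000} (j/47)(j/19) j⁸` evaluated (`decide +kernel`). [folklore] -/
theorem theta2_D47_block3 :
    ∑ j ∈ Finset.Ico (4500 : ℕ) 6000, (legendreSym 47 (j : ℤ) * legendreSym 19 (j : ℤ)) * (j : ℤ) ^ (7 + 1) =
      -14853760775745962707661383976282 := by
  simp_rw [legendreSym_eq_ite 47 (by norm_num), legendreSym_eq_ite 19 (by norm_num)]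
  decide +kernel

set_option maxRecDepth 400000 in
/-- Block 4 of the `θ₂` certificate for `D = −47`: `Σ_{6000 ≤ j < 6251} (j/47)(j/19) j⁸` evaluated (`decide +kernel`). [folklore] -/
theorem theta2_D47_block4 :
    ∑ j ∈ Finset.Ico (6000 : ℕ) (7 * 47 * 19), (legendreSym 47 (j : ℤ) * legendreSym 19 (j : ℤ)) * (j : ℤ) ^ (7 + 1) =
      17210774487188960440018018940605 := by
  simp_rw [legendreSym_eq_ite 47 (by norm_num), legendreSym_eq_ite 19 (by norm_num)]
  decide +kernel

/-- The `θ₂` certificate sum for `D = −47` assembled from its blocks: `Σ_{j<6251} (j/47)(j/19) j⁸ = S₂` with `7 ∥ S₂`. [folklore] -/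
theorem theta2_D47_sum :
    ∑ j ∈ Finset.range (7 * 47 * 19), (legendreSym 47 (j : ℤ) * legendreSym 19 (j : ℤ)) * (j : ℤ) ^ (7 + 1) =
      2771862185382992258868628796864 := by
  rw [Finset.range_eq_Ico, ← Finset.sum_Ico_consecutive _ (show 0 ≤ 1500 by norm_num) (show 1500 ≤ 7 * 47 * 19 by norm_num), ← Finset.sum_Ico_consecutive _ (show 1500 ≤ 3000 by norm_num) (show 3000 ≤ 7 * 47 * 19 by norm_num), ← Finset.sum_Ico_consecutive _ (show 3000 ≤ 4500 by norm_num) (show 4500 ≤ 7 * 47 * 19 by norm_num), ← Finset.sum_Ico_consecutive _ (show 4500 ≤ 6000 by norm_num) (show 6000 ≤ 7 * 47 * 19 by norm_num), theta2_D47_block0, theta2_D47_block1, theta2_D47_block2, theta2_D47_block3, theta2_D47_block4]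
  norm_num

set_option maxRecDepth 400000 in
/-- **`‖B_{1,θ₂}‖₇ = 1`** for every character `θ₂` mod `7·47·19` with values `(j/47)·J(j | 19)·ω(j)`
(certificate `7 ∥ Σ_{j<6251} (j/47)(j/19) j⁸`, `decide +kernel`).
[cite: KrizLi2019, Thm. 1.20 (p. 8) and §1.5 (1)] [cite: Washington1997, §5.1 and Thm. 4.2] -/
theorem norm_generalizedBernoulli_theta2_D47 (ω : DirichletCharacter ℚ_[7] 7)
    (hω : IsTeichmullerCharacter ω) (θ : DirichletCharacter ℚ_[7] (7 * 47 * 19))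
    (hθ : ∀ j : ZMod (7 * 47 * 19), θ j =
      ((legendreSym 47 (j.val : ℤ) * jacobiSym (j.val : ℤ) 19 : ℤ) : ℚ_[7]) * ω (j.val : ZMod 7) ^ 1) :
    ‖generalizedBernoulli 1 θ‖ = 1 := by
  have hθ' : ∀ j : ZMod (7 * 47 * 19), θ j =
      ((legendreSym 47 (j.val : ℤ) * legendreSym 19 (j.val : ℤ) : ℤ) : ℚ_[7]) * ω (j.val : ZMod 7) ^ 1 :=
    fun j => by rw [hθ j, ← jacobiSym.legendreSym.to_jacobiSym]
  have hθ1 : θ ≠ 1 := by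
    intro h1
    have hv := hθ' (((6250 : ℕ)) : ZMod (7 * 47 * 19))
    have hval : (((6250 : ℕ) : ZMod (7 * 47 * 19))).val = 6250 := by
      rw [ZMod.val_natCast]
    have hu : IsUnit (((6250 : ℕ)) : ZMod (7 * 47 * 19)) := by
      rw [ZMod.isUnit_iff_coprime]; norm_num
    rw [h1, hval, MulChar.one_apply hu, pow_one] at hv
    have hL : legendreSym 47 ((6250 : ℕ) : ℤ) * legendreSym 19 ((6250 : ℕ) : ℤ) = 1 := by
      rw [legendreSym_eq_ite 47 (by norm_num), legendreSym_eq_ite 19 (by norm_num)]; decide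
    rw [hL, Int.cast_one, one_mul] at hv
    -- `ω(−1) = 1` contradicts `‖ω(6) − 6‖ < 1`
    have h6 : (((6250 : ℕ)) : ZMod 7) = ((6 : ℤ) : ZMod 7) := by decide
    rw [h6] at hv
    have hT := hω 6 (by decide)
    rw [← hv] at hT
    have : ‖(1 : ℚ_[7]) - ((6 : ℤ) : ℚ_[7])‖ = 1 := by
      rw [show (1 : ℚ_[7]) - ((6 : ℤ) : ℚ_[7]) = -((5 : ℕ) : ℚ_[7]) by norm_num, norm_neg]
      exact Padic.norm_natCast_eq_one_iff.mpr (by decide)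
    rw [this] at hT
    exact lt_irrefl _ hT
  refine norm_generalizedBernoulli_one_eq_one_of_cert_range θ hθ1 padicValNat_seven_level2_D47
    (fun j => legendreSym 47 (j : ℤ) * legendreSym 19 (j : ℤ)) 7 (fun j => ?_) 2771862185382992258868628796864
    theta2_D47_sum (by norm_num) (by norm_num)
  have := norm_sub_le_of_values ω hω θ (fun m => legendreSym 47 (m : ℤ) * legendreSym 19 (m : ℤ))
    1 le_rfl hθ' j
  simpa using this

/-- **ROUTE U, member `D = −47` (`49a1^{(−47)}`, `N = 49·47² = 108241`): BSD₇ for every globally minimal model of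
`49a1^{(−47)}` with `r_an = 1`**, by the prime-member class theorem at `(q, r) = (47, 19)` with the two
certificates above; the descent inputs (no `7`-torsion over `K`, `7 ∤ #Ш(W)`) are discharged inside the
class theorem (Mazur's local step; Buhler–Gross 1985 Ch. II BY NAME, binder `hBG`).
[cite: KrizLi2019, Thm. 1.20 and Rem. 3.10] [cite: Rubin1983, §0 Thm. C (p. 341)]
[cite: BurungaleFlach2024, Thm 1.1 and Cor. 2] [cite: GrossZagier1986, I.(6.5) and V.(2.1)]
[cite: Miller2011LMS, Thm. 2.5 and (5.1)] [cite: BuhlerGross1985, Ch. II (7.2)(2), (8.3)(1), (9.1) (pp. 16–18)] -/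
theorem bsdp_seven_of_twist_cm7_D47
    (hKL : KrizLi2019.thm120_padicLogHeegner_unit_of_bernoulli)
    (hRem : KrizLi2019.rem310_padicLogHeegner_integral)
    (W : WeierstrassCurve ℚ) [W.IsElliptic] [W.IsGloballyMinimal] [NeZero (W.conductorNorm ℤ)]
    (hW : ∃ C : VariableChange ℚ, C • W = cm7.quadraticTwist ((-(47 : ℕ) : ℤ) : ℚ))
    (K : Type) [Field K] [NumberField K] [NeZero (NumberField.discr K).natAbs]
    (hK : IsImaginaryQuadratic K) (hdK : NumberField.discr K = -(19 : ℕ))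
    (D : ModularParametrizationData W (W.conductorNorm ℤ))
    (H : HeegnerDatum (W.conductorNorm ℤ) (NumberField.discr K)) (ι : K →+* ℂ) (ιp : K →+* ℚ_[7])
    (P : (W.baseChange K).toAffine.Point)
    (hGZ : gross_zagier (W.conductorNorm ℤ) W K) (hKo : kolyvagin (W.conductorNorm ℤ) W K)
    (hGZK : rank_eq_analyticRank_of_analyticRank_le_one) (hmod : hasEntireLFunction_rat)
    (hP : WeierstrassCurve.Affine.Point.map ι.toRatAlgHom P = heegnerPointComplex D H)
    (hr1 : W.analyticRank = 1)
    (hLt : (W.quadraticTwist (NumberField.discr K : ℚ)).entireLFunction 1 ≠ 0)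
    (Wd : WeierstrassCurve ℚ) [Wd.IsElliptic] [Wd.IsGloballyMinimal] (Cd : VariableChange ℚ)
    (hWd : Cd • W.quadraticTwist (NumberField.discr K : ℚ) = Wd)
    (hBF : bsdTriple_of_hasCM_of_L_one_ne_zero)
    (hu : padicValRat 7 (Cd.u : ℚ) = 0)
    (hC : Rubin1983.thmC_seven_quadraticField)
    (hBG : BuhlerGross1985.firstDescent_seven_oddTwist_of_bernoulli)
    [Finite (AddCommGroup.torsion (W.baseChange K).toAffine.Point)]
    (crd : (W.baseChange K).toAffine.Point →+ ℤ) (g : (W.baseChange K).toAffine.Point)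
    (hg : crd g = 1) (hker : ∀ x, crd x = 0 → IsOfFinAddOrder x)
    (hc7 : ¬ ((7 : ℤ) ∣ D.c)) :
    BSDp W 7 :=
  bsdp_seven_of_twist_cm7_prime (q := 47) (r := 19) (by norm_num) (by norm_num) (by norm_num)
    (by norm_num) (by norm_num) (by norm_num)
    (by rw [legendreSym_eq_ite 7 (by norm_num)]; decide)
    (by rw [legendreSym_eq_ite 47 (by norm_num)]; decide)
    (norm_generalizedBernoulli_theta1_D47) (norm_generalizedBernoulli_theta2_D47)
    hKL hRem W hW K hK hdK D H ι ιp P hGZ hKo hGZK hmod hP hr1 hLt Wd Cd hWd hBF hu hC hBG crd g hg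
    hker hc7


end Summit.BirchSwinnertonDyer.Rank1Residual.X12.O11.RouteU

end
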